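import Summits.KontsevichZagierPeriods.KontsevichZagierPeriods.Theses.SphericalSchlafli
import Summits.KontsevichZagierPeriods.KontsevichZagierPeriods.Theorems.FurushoPentagonSectorToKernelAyoubKernelOnResolved
import Summits.KontsevichZagierPeriods.KontsevichZagierPeriods.Theorems.FurushoPentagonSectorToKernelCubeResolutionOfNash
import Summits.KontsevichZagierPeriods.KontsevichZagierPeriods.Theorems.LiftingCriteriaCubeNashNormalFormDimLeOne

/-!
# `VolumeForm` (stmt-KontsevichZagierPeriods-3814; routes SphericalSchlafli / SymplecticScissors / WeightFloor …)
# — SPLIT GLUE through Ayoub's compact presentation: `CubeResolution → AyoubEffectiveCubeKernel → VolumeForm`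

Crux-strategist decomposition (RESTATED re-audit, BC2 redirect) of the frame item `VolumeForm` — "two
integrand-`1` representations of one dimension with equal volume are KZ-equivalent", kernel-checked
equivalent to the summit (`HermiteRigidity.ReductionRigidity.volumeForm_iff_kontsevichZagierPeriods`) — into
the two leaves ALREADY FILED hub-wide for the sibling frame crux `ReductionRigidity` (stmt-3407, items
stmt-17978 / stmt-18116, `Cruxes/ReductionRigidity/SplitR1Glue.lean`), so that both summit-equivalent
deciding cruxes redirect to ONE pair of pieces:

* **X₁ = `CubeResolution`** (stmt-17978; GEOMETRY INSIDE THE RULES, transcendence-free, Hironaka strength):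
  every integral representation is congruent modulo `KZ.relations` to a `ℤ`-combination of TAME CUBE
  classes `[[0,1]ⁿ, f]`, `f` real analytic on a neighbourhood of the closed cube (`h1` below, import-free;
  = stub S1 of crux 10813 / S1b of crux 3929; ⟸ item 3574 by `cubeResolution_of_cubeNashNormalForm`;
  reduced by landed theorems to the cube–Nash normal form of BOUNDED BODIES in ambient dimension `≥ 3`
  — `cubeNashNormalForm_of_boundedCubeResolution_three`, `cubeResolution_of_boundedVolumes`; dimension
  `≤ 1` and bounded plane bodies are theorems: `CubeNashNormalFormDimLeOne`, `…VolumeTwo`). For a VOLUME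
  route this is the natural normal form: "every bounded `ℚ`-semialgebraic body is, by moves, an integral
  over the unit cube of a function analytic up to the boundary".
* **X₂ = `AyoubEffectiveCubeKernel`** (stmt-18116; TRANSCENDENCE in Ayoub's linear presentation, printed
  open conjecture: Ayoub, Ann. of Math. 181 (2015) Conj. 1.1 = Fresán, X-UPS 2024 Conj. 3.5, at `k = ℚ`):
  the kernel of `∫_{[0,1]^∞}` on `𝒪_{ℚ-alg}(𝔻̄^∞)` is the `ℚ`-span of the Stokes elements
  `∂G/∂zᵢ − G|_{zᵢ=1} + G|_{zᵢ=0}` — an explicit GENERATING FAMILY for all vanishing periods (`h6` below,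
  verbatim stub S6 of crux 10813; ⟺ the conjecture leaf `TypeAGenerationConjecture` by
  `AyoubRel.typeAGeneration_forall_iff_rat`, not named here so that no conjecture constant enters the cone).

ASSEMBLY `VolumeForm_of_cubes` (this file, the construction written out; every step a LANDED theorem):
given bodies `r`, `r'` of one dimension with `vol r = vol r'`, put `c = [r] − [r']`, `eval c = 0`;
(1) RESOLVE both bodies (X₁): `c ≡ a − a'` in the tame cubical span; (2) MERGE to one tame cube class `[t]`
(`ReducedPeriodRing.stub_cubeMerge`: integrand additivity on the cube, dummy variables); (3) make it
Ayoub-ADMISSIBLE, `[t] ≡ [s]`, `s` the sum on the closed cube of ONE power series of polyradius `> 1`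
algebraic over `ℚ[z]` (`stub_admissibleOfTame`); (4) SOUNDNESS: `∫_{[0,1]ⁿ} s = eval c = 0`;
(5) X₂ ⟹ the padded integrand `s ∘ pr` on `[0,1]ⁿ⁺ᵈ` is a REAL STOKES COMBINATION
`Σⱼ (∂Hⱼ/∂x_{iⱼ} − Hⱼ|_{x_{iⱼ}=1} + Hⱼ|_{x_{iⱼ}=0})`, `Hⱼ` analytic and algebraic (`stub_realStokesForm`),
hence `ℚ`-semialgebraic (`stub_semialgebraicOfAlgebraic`); (6) PAD by `d` dummy variables
(`[s] ≡ [s × [0,1]ᵈ]`, one Newton–Leibniz move) and CALIBRATE: each Stokes element is one Newton–Leibniz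
move along its own axis after a coordinate permutation (rule 2), their sum is integrand additivity
(rule 1b), so `[s × [0,1]ᵈ] ∈ KZ.relations` (`stub_stokesSpanCalibration`); (7) hence `c ∈ KZ.relations`,
i.e. `KZ.Equivalent r r'`. Steps (2)–(6) are the landed composition of line `effective-cube-surjection`
(`kzKernel_of_ayoubKernel_of_resolved`, Theorems/FurushoPentagonSectorToKernelAyoubKernelOnResolved.lean,
with ≈ 3 000 landed lines of transfer lemmas behind the five stubs); the seam is a CHANGE OF PRESENTATION
(semialgebraic domains and rule (2) on one side; one function space with commuting `∂ᵢ` and face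
restrictions on the other), the opposite of an `exact ⟨h₁, h₂⟩` seam.

STRENGTH RECORD (honest, = the record of SplitR1Glue): in print X₂ is "a reformulation" of the period
conjecture (Ayoub 2015, Fait 1.4, through Ayoub's motivic `𝒫_KZ`); in the TREE X₂ and the summit / the frame
are INCOMPARABLE — `X₂ → VolumeForm` is known only through X₁ (this file), `VolumeForm → X₂` would be a
conservativity theorem of the naive move calculus over Ayoub's Stokes span (open; stub S2 of line
`ayoub_stokes_cartier`); `X₁ → VolumeForm` needs X₂, `VolumeForm → X₁` needs the value-level cube
presentation (HMS 2017 Thm. 12.2.1) inside the rules. Cheap probes `Xᵢ → KontsevichZagierPeriods`,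
`Xᵢ → VolumeForm` fail (strategist folder `bc/`, and `Cruxes/ReductionRigidity/SplitR1-PROBES.md`).

For the prover landing the glue item `VolumeFormOfCubes : CubeResolution → AyoubEffectiveCubeKernel →
VolumeForm` of route SphericalSchlafli: `theorem volumeFormOfCubes_proof : VolumeFormOfCubes :=
fun h1 h6 => VolumeForm_of_cubes h1 h6` (the route children unfold definitionally to `h1`, `h6` below).

References: M. Kontsevich, D. Zagier, *Periods* (2001), §1.1–1.2; J. Ayoub, Ann. of Math. 181 (2015),
Conj. 1.1, Rem. 1.2, Fait 1.4; J. Ayoub, EMS Newsl. 91 (2014), Def. 9–10, Prop. 11, Rem. 12–13; J. Fresán,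
*Une introduction aux périodes*, X-UPS 2024, Conj. 3.5; A. Huber, S. Müller-Stach, *Periods and Nori
Motives* (2017), §12.2; J. Viu-Sos, IJNT 17 (2021), Thm. 1.1; J. Cresson, J. Viu-Sos, JTNB 34 (2022), §1;
H. Hironaka, Ann. of Math. 79 (1964); E. Bierstone, P. Milman, Publ. IHÉS 67 (1988), §4.
-/

noncomputable section

namespace Summit.KontsevichZagierPeriods.SphericalSchlafli.VolumeFormOfCubes

open Set MeasureTheory
open Literature.NumberTheory.Transcendental
open Literature.NumberTheory.Transcendental.KZ hiding cubicalSpan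
open Summit.KontsevichZagierPeriods.FurushoPentagon.ReducedPeriodRing (unitCube cubicalGens cubicalSpan
  stub_cubeMerge)
open Summit.KontsevichZagierPeriods.FurushoPentagon.SectorToKernel

/-- **X₁ ⟹ resolution in the tree's vocabulary**: the import-free child `CubeResolution` (stmt-17978) is,
up to unfolding `ReducedPeriodRing.unitCube` / `cubicalGens` / `cubicalSpan`, the registered stub S1.
[Ayoub 2014, Rem. 12] [folklore] -/
theorem resolved_of_cubeResolution
    (h1 : ∀ (N : ℕ) (u : Literature.NumberTheory.Transcendental.KZ.IntegralRep N), ∃ c ∈ AddSubgroup.closure {d : Literature.NumberTheory.Transcendental.KZ.FormalRep | ∃ (n : ℕ) (r : Literature.NumberTheory.Transcendental.KZ.IntegralRep n), r.domain = {x : Fin n → ℝ | ∀ i, 0 ≤ x i ∧ x i ≤ 1} ∧ AnalyticOnNhd ℝ r.integrand {x : Fin n → ℝ | ∀ i, 0 ≤ x i ∧ x i ≤ 1} ∧ d = Literature.NumberTheory.Transcendental.KZ.of r}, Literature.NumberTheory.Transcendental.KZ.of u - c ∈ Literature.NumberTheory.Transcendental.KZ.relations)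
    (N : ℕ) (u : IntegralRep N) : ∃ a : FormalRep, a ∈ cubicalSpan ∧ of u - a ∈ relations := by
  obtain ⟨c, hc, e⟩ := h1 N u
  exact ⟨c, hc, e⟩

/-- **SPLIT GLUE — `CubeResolution → AyoubEffectiveCubeKernel → VolumeForm`** (the Ayoub seam; proof =
the construction (1)–(7) of the module docstring, every step a landed theorem of the tree).
[Ayoub 2015, Conj. 1.1; Ayoub 2014, Rem. 12–13; Kontsevich–Zagier 2001, §1.2] -/
theorem VolumeForm_of_cubes
    (h1 : ∀ (N : ℕ) (u : Literature.NumberTheory.Transcendental.KZ.IntegralRep N), ∃ c ∈ AddSubgroup.closure {d : Literature.NumberTheory.Transcendental.KZ.FormalRep | ∃ (n : ℕ) (r : Literature.NumberTheory.Transcendental.KZ.IntegralRep n), r.domain = {x : Fin n → ℝ | ∀ i, 0 ≤ x i ∧ x i ≤ 1} ∧ AnalyticOnNhd ℝ r.integrand {x : Fin n → ℝ | ∀ i, 0 ≤ x i ∧ x i ≤ 1} ∧ d = Literature.NumberTheory.Transcendental.KZ.of r}, Literature.NumberTheory.Transcendental.KZ.of u - c ∈ Literature.NumberTheory.Transcen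dental.KZ.relations)
    (h6 : ∀ F ∈ Literature.NumberTheory.Transcendental.AyoubRel.Oan (Rat.castHom ℂ), Literature.NumberTheory.Transcendental.AyoubRel.intC F = 0 → F ∈ Literature.NumberTheory.Transcendental.AyoubRel.kSpan (Rat.castHom ℂ) {x : Literature.NumberTheory.Transcendental.AyoubRel.CSeries | ∃ G ∈ Literature.NumberTheory.Transcendental.AyoubRel.Oan (Rat.castHom ℂ), ∃ i : ℕ, x = Literature.NumberTheory.Transcendental.AyoubRel.relAC i G}) :
    Summit.KontsevichZagierPeriods.KontsevichZagierPeriods.Theses.SphericalSchlafli.VolumeForm := by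
  intro N r r' _h1 _h1' hv
  -- the class to be shown a relation, and its value
  set c : FormalRep := of r - of r' with hc_def
  have hc0 : eval c = 0 := by
    rw [hc_def, map_sub, eval_of, eval_of, hv, sub_self]
  -- (1) RESOLUTION inside the rules (piece X₁): `c ≡ a − a'`, a `ℤ`-combination of tame cube classes
  obtain ⟨a, ha, hra⟩ := resolved_of_cubeResolution h1 N r
  obtain ⟨a', ha', hra'⟩ := resolved_of_cubeResolution h1 N r'
  have hca : c - (a - a') ∈ relations := by
    have e : c - (a - a') = (of r - a) - (of r' - a') := by rw [hc_def]; abel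
    rw [e]
    exact relations.sub_mem hra hra'
  -- (2) MERGE into one tame cube class `[t]`
  obtain ⟨n, t, htd, hta, hat⟩ := stub_cubeMerge (a - a') (cubicalSpan.sub_mem ha ha')
  rw [leaves_unitCube_eq_cube] at htd hta
  -- (3) Ayoub-ADMISSIBLE expansion `[t] ≡ [s]`
  obtain ⟨s, hsd, hadm, hts⟩ := stub_admissibleOfTame n t htd hta
  have hcs : c - of s ∈ relations := by
    have e : c - of s = (c - (a - a')) + ((a - a') - of t) + (of t - of s) := by abel
    rw [e]
    exact relations.add_mem (relations.add_mem hca hat) hts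
  -- (4) SOUNDNESS: `∫_{[0,1]ⁿ} s = eval c = 0`
  have hs0 : ∫ x in KZ.cube n, s.integrand x = 0 := by
    have h0 : eval (c - of s) = 0 := relations_le_ker_eval_holds hcs
    rw [map_sub, hc0, zero_sub, neg_eq_zero, leaves_eval_of_eq_setIntegral_cube s hsd] at h0
    exact h0
  -- (5) piece X₂: REAL STOKES FORM of the padded integrand, with analytic algebraic (hence
  --     `ℚ`-semialgebraic) primitives
  obtain ⟨d, k, i, H, hH, hid⟩ := stub_realStokesForm h6 n s hsd hadm hs0
  have hHs : ∀ j, AnalyticOnNhd ℝ (H j) (KZ.cube (n + d)) ∧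
      IsSemialgebraicFunOn ℚ (KZ.cube (n + d)) (H j) :=
    fun j => ⟨(hH j).1, stub_semialgebraicOfAlgebraic (n + d) (H j) (hH j).1 (hH j).2⟩
  -- (6) PAD `s` by `d` dummy variables and CALIBRATE the Stokes combination inside the rules
  obtain ⟨u, hud, hui⟩ := leaves_exists_oneCube d
  have hpd : (s.prod u).domain = KZ.cube (n + d) := by
    rw [IntegralRep.prod_domain, leaves_prodDomain_eq_cube s u hsd hud]
  have hpi : ∀ z ∈ KZ.cube (n + d), (s.prod u).integrand z =
      ∑ j, (fderiv ℝ (H j) z (Pi.single (i j) 1) - H j (Function.update z (i j) 1) +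
        H j (Function.update z (i j) 0)) := by
    intro z hz
    rw [leaves_prod_oneCube_integrand s u hui z]
    exact hid z hz
  have hpad : of (s.prod u) ∈ relations :=
    stub_stokesSpanCalibration (n + d) (s.prod u) hpd k i H hHs hpi
  have hsu : of s - of (s.prod u) ∈ relations := leaves_of_sub_of_prod_oneCube s u hud hui
  -- (7) conclude: `[r] − [r'] ∈ KZ.relations`
  have e : c = (c - of s) + (of s - of (s.prod u)) + of (s.prod u) := by abel
  show of r - of r' ∈ relations
  rw [← hc_def, e]
  exact relations.add_mem (relations.add_mem hcs hsu) hpad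

/-- The pieces imply Kontsevich–Zagier's Conjecture 1 — directly by the landed composition of line
`effective-cube-surjection` (`kontsevichZagierPeriods_of_cubeResolution_of_ayoubKernel`); equivalently through
the frame (`volumeForm_iff_kontsevichZagierPeriods`, Theorems/HermiteRigidityReductionRigidityFrame.lean).
[Ayoub 2015, §1.1; Viu-Sos 2021, Thm. 1.1] [folklore] -/
theorem kontsevichZagierPeriods_of_cubes
    (h1 : ∀ (N : ℕ) (u : Literature.NumberTheory.Transcendental.KZ.IntegralRep N), ∃ c ∈ AddSubgroup.closure {d : Literature.NumberTheory.Transcendental.KZ.FormalRep | ∃ (n : ℕ) (r : Literature.NumberTheory.Transcendental.KZ.IntegralRep n), r.domain = {x : Fin n → ℝ | ∀ i, 0 ≤ x i ∧ x i ≤ 1} ∧ AnalyticOnNhd ℝ r.integrand {x : Fin n → ℝ | ∀ i, 0 ≤ x i ∧ x i ≤ 1} ∧ d = Literature.NumberTheory.Transcendental.KZ.of r}, Literature.NumberTheory.Transcendental.KZ.of u - c ∈ Literature.NumberTheory.Transcendental.KZ.relations)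
    (h6 : ∀ F ∈ Literature.NumberTheory.Transcendental.AyoubRel.Oan (Rat.castHom ℂ), Literature.NumberTheory.Transcendental.AyoubRel.intC F = 0 → F ∈ Literature.NumberTheory.Transcendental.AyoubRel.kSpan (Rat.castHom ℂ) {x : Literature.NumberTheory.Transcendental.AyoubRel.CSeries | ∃ G ∈ Literature.NumberTheory.Transcendental.AyoubRel.Oan (Rat.castHom ℂ), ∃ i : ℕ, x = Literature.NumberTheory.Transcendental.AyoubRel.relAC i G}) :
    _root_.KontsevichZagierPeriods :=
  kontsevichZagierPeriods_of_cubeResolution_of_ayoubKernel (resolved_of_cubeResolution h1) h6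

/-! ## The volume dress of X₁ (what the VOLUME route's provers attack): bounded bodies in ambient dimension ≥ 3 -/

/-- **X₁ from the cube–Nash normal form of BOUNDED BODIES in ambient dimension `≥ 3`** (landed
reductions: Viu-Sos' bounded reduction, dimension `≤ 1`, bounded plane bodies, tame ↔ cube–Nash): if every
bounded integrand-`1` body `∫_K 1`, `K ⊆ ℝ^{m+3}`, is congruent modulo `KZ.relations` to an element of the
tame cubical span, then `CubeResolution` holds. So for this VOLUME route the geometry piece reads: "every
bounded `ℚ`-semialgebraic solid of dimension `≥ 3` is, by moves, an integral over the unit cube of a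
function analytic up to the boundary" — embedded resolution of the boundary inside the rules.
[Viu-Sos 2021, Thm. 1.1; Hironaka 1964; Bierstone–Milman 1988, §4] [folklore] -/
theorem cubeResolution_of_boundedBodiesThree
    (H3 : ∀ (m : ℕ) (K : IntegralRep (m + 3)), Bornology.IsBounded K.domain →
      (∀ x ∈ K.domain, K.integrand x = 1) → ∃ c : FormalRep, c ∈ cubicalSpan ∧ of K - c ∈ relations) :
    ∀ (N : ℕ) (u : Literature.NumberTheory.Transcendental.KZ.IntegralRep N), ∃ c ∈ AddSubgroup.closure {d : Literature.NumberTheory.Transcendental.KZ.FormalRep | ∃ (n : ℕ) (r : Literature.NumberTheory.Transcendental.KZ.IntegralRep n), r.domain = {x : Fin n → ℝ | ∀ i, 0 ≤ x i ∧ x i ≤ 1} ∧ AnalyticOnNhd ℝ r.integrand {x : Fin n → ℝ | ∀ i, 0 ≤ x i ∧ x i ≤ 1} ∧ d = Literature.NumberTheory.Transcendental.KZ.of r}, Literature.NumberTheory.Transcendental.KZ.of u - c ∈ Literature.NumberTheory.Transcendental.KZ.relations := by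
  intro N u
  obtain ⟨c, hc, e⟩ := cubeResolution_of_cubeNashNormalForm
    (Summit.KontsevichZagierPeriods.LiftingCriteria.CubeNashNormalFormDimLeOne.cubeNashNormalForm_of_boundedCubeResolution_three
      H3) N u
  exact ⟨c, hc, e⟩

end Summit.KontsevichZagierPeriods.SphericalSchlafli.VolumeFormOfCubes

end
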